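import Summits.MatrixMultiplication.MatrixMultiplication.Theses.CondensationDistance

/-!
# Disproof of `DerivationsBoundOmega` (stmt-MatrixMultiplication-15940) — findings, cdisprove cycle 1

Route `route-MatrixMultiplication-CondensationDistance`, crux rank 6, the literature bridge
"`ω ≤ ω(Det)`" (Bürgisser–Clausen–Shokrollahi 1997, Thm. (16.7), second half) in the tree's
currencies (`Derivable ℂ` = BCS Ω-computation sequences over `Frac ℂ[Z]`, ALL steps counted,
constants `ℂ` free; `omega ℂ` = rank exponent). refuter-cdisprove-…-15940-0, 2026-08-17.
Everything below is sorry-free, axioms `{propext, Classical.choice, Quot.sound}`.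

VERDICT: **no kill — the crux resists.** It is a theorem of the literature in a faithful model, and
`summit_implies_crux_body` (CruxAttack.lean, rattack r1, USED here as the frame of the analysis)
shows `¬C ⊢ ω(ℂ) > 2`: no refutation exists short of disproving the summit. The picked line `birth`
(PICKED.md) discharges it from in-tree theorems; its stub 3 `stub_borderRankExponent` is already
landed (p160924), stubs 1–2 are instantiations (`Theorems.stub_pairs`, `Andrews2022_thm3_holds`).

## (a) Load-bearing analysis — one theorem per hypothesis / structural feature

* guard `2 ≤ τ` — **IDLE**: `derivationsBoundOmega_iff_allExponents : C ↔ (C with the guard dropped)`.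
  Mechanism: the first LOWER bound in the `Derivable` model, `sq_le_two_mul_of_derivable_detX`
  (a derivation of `det X_n`, `n ≥ 2`, from the entries of `Z` has length `≥ n²/2`: each step reads
  ≤ 2 inputs — `divSeq_exists_finset_fixed` — and `det X` is moved by rescaling any single entry
  `X_{ij} ↦ 2X_{ij}` — `scaleHom_detX_ne`, evaluation at a transposition matrix), whence
  `not_hyp_of_lt_two : τ < 2 → ¬ Hyp τ`. Information for provers: no proof needs the guard.
* scalars `k = ℂ` (first argument of `Derivable`) — **load-bearing to the hilt**:
  `derivationsBoundOmegaFieldScalars_iff : (variant with Derivable K, K = Frac ℂ[Z]) ↔ ω(ℂ) ≤ 2`,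
  i.e. THE SUMMIT (everything is a free constant, `s = 0`). Not refutable either; a warning never to
  generalise the scalar argument.
* cost bound `s ≤ C·n^τ` — **load-bearing to the hilt**: `derivationsBoundOmegaNoCostBound_iff :
  (variant without the bound) ↔ ω(ℂ) ≤ 2`; the unbounded hypothesis is a THEOREM (`derivable_detX`:
  Leibniz expansion, `(n+1)!` steps — also the non-vacuity witness of the hypothesis PREDICATE for
  every `n`, extending rattack's `n = 1, 2`).
* quantifier order `∃ C ∀ n` — **load-bearing**: `derivationsBoundOmegaPointwiseConstant_iff :
  (variant with ∃ C inside ∀ n) ↔ ω(ℂ) ≤ 2` (`C := (n+1)!`).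
* asymptotics `∃ n₀ ∀ n ≥ n₀` — **load-bearing, and here a genuine refutation of the natural
  strengthening** (c): `not_derivationsBoundOmegaSingleInstance` — "one size `n ≥ 2` with a
  derivation of length `≤ n^τ` gives `ω ≤ τ`" is FALSE: `det X₂` costs `3 = 2^{log₂ 3}` steps
  (`derivable_detX_two`), which would give `ω(ℂ) ≤ log₂ 3 < 2 ≤ ω(ℂ)`. (Infimum-not-minimum: no
  single `n` certifies an exponent through a TOTAL-count determinant bridge; contrast bilinear rank,
  where one `n` does, by tensor powers.)
* `m'` unbounded above, `n₀`, sign of `C`, `n = 0, 1` — harmless (paper; rattack r1 §4): extra generic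
  columns specialise to free constants (ℂ infinite); the Andrews line needs no specialisation at all.

## (b) Tightness / boundary
* `not_hyp_of_lt_two` is the boundary: the hypothesis family `Hyp τ` is EMPTY for `τ < 2` and (paper)
  inhabited for every `τ > ω(Det) = ω` (Gaussian elimination at `τ = 3`); the crux's live content is
  `τ ∈ [2, 3)` (rattack: the slice `τ ≥ 3` holds with the hypothesis unused).
* The fan-in constant: `n²/2` vs the true `Ω(n²)`-with-better-constant is immaterial for exponents.

## (c) Natural strengthenings refuted in small models
* `not_derivationsBoundOmegaSingleInstance` (model `n = 2`, 3 steps), above.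
* NOT refutable (each is `↔ ω(ℂ) ≤ 2`): dropping the cost bound, the scalar restriction, or the
  uniformity of `C`; strengthening the conclusion to `ω < τ` (unknown at `τ = 2`).

## (d) Targets (lead's stuck stubs)
None this cycle (`stuck_stubs = []`). Degenerate-instance sanity of the picked line's stubs (paper /
definitions read): `stub_pairsSimulation` at `n ≤ 1`, `s = 0` holds with `q = 1` (variables and
constants have `complexity 0`: output operand may be `var`/`const` with no gate); `stub_andrewsLeadingBlock`
at `t = 0` is `0 ≤ _` (empty tensor); `stub_borderRankExponent` (landed) is vacuous for `τ < 2`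
(`bR(⟨q,q,q⟩) ≤ 1 ⇒ ω ≤ 0` via `Blaser2013_thm66_holds.cubic`, so `bR ≥ 2` for `q ≥ 2` in tree) and
handles `A ≤ 0` the same way. No degenerate kill.

## (e) Near-misses
None: nothing here is sorried. WHY IT RESISTS, in one line: every weakening of a hypothesis is either
still true (guard) or collapses to `ω(ℂ) ≤ 2` (scalars, cost, uniformity) — never to a refutable
statement — and the model transfer, the only checkable content, is an instantiation of in-tree theorems.

Barrier catalogue (`Literature/Barriers/MatrixMultiplication/`): not applicable (upper-bound transfer
lemma, no design / tensor-power / rank-method object). Negatives index: no `Derivable`/`omega` bridge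
entry (`ledger negatives`: design/STPP items only).
-/

set_option linter.dupNamespace false

noncomputable section

namespace Summit.MatrixMultiplication.MatrixMultiplication.Cruxes.DerivationsBoundOmega.Disproof

open Literature.Computability.AlgebraicComplexity
open Summit.MatrixMultiplication.MatrixMultiplication.Theses.CondensationDistance

universe u v

section Model

variable {k : Type u} {K : Type v} [CommSemiring k] [Field K] [Algebra k K]

/-- **Fan-in bookkeeping for computation sequences.** A computation sequence of length `ℓ` over the
available set `A` READS at most `2ℓ` elements of `A`: there is a finite `U ⊆ A`, `|U| ≤ 2ℓ`, such that
every ring endomorphism of `K` fixing the constants and `U` pointwise fixes every element of the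
sequence. [folklore] -/
theorem divSeq_exists_finset_fixed :
    ∀ (l : List K) (A : Set K), DivSeq k A l →
      ∃ U : Finset K, (↑U : Set K) ⊆ A ∧ U.card ≤ 2 * l.length ∧
        ∀ φ : K →+* K, (∀ c : k, φ (algebraMap k K c) = algebraMap k K c) →
          (∀ u ∈ U, φ u = u) → ∀ v ∈ l, φ v = v := by
  classical
  intro l
  induction l with
  | nil =>
    intro A _
    exact ⟨∅, by simp, by simp, fun _ _ _ v hv => by simp at hv⟩
  | cons v l ih =>
    intro A hA
    obtain ⟨x, hx, y, hy, hv⟩ := hA.1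
    obtain ⟨U', hU'A, hU'card, hU'fix⟩ := ih (insert v A) hA.2
    let S : Finset K := ({x, y} : Finset K).filter (· ∈ A)
    refine ⟨U'.erase v ∪ S, ?_, ?_, ?_⟩
    · intro u hu
      simp only [Finset.coe_union, Finset.coe_erase, Set.mem_union, Set.mem_sdiff, Finset.mem_coe,
        Set.mem_singleton_iff] at hu
      rcases hu with ⟨hu, hne⟩ | hu
      · rcases (Set.mem_insert_iff.1 (hU'A hu)) with h | h
        · exact absurd h hne
        · exact h
      · exact (Finset.mem_filter.1 hu).2
    · have h1 : (U'.erase v ∪ S).card ≤ (U'.erase v).card + S.card := Finset.card_union_le _ _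
      have h2 : (U'.erase v).card ≤ U'.card := Finset.card_erase_le
      have h3 : S.card ≤ ({x, y} : Finset K).card := Finset.card_filter_le _ _
      have h4 : ({x, y} : Finset K).card ≤ 2 := Finset.card_le_two
      simp only [List.length_cons]
      omega
    · intro φ hφc hφU
      -- `φ` fixes `x` and `y`
      have fixA : ∀ z ∈ A ∪ Set.range (algebraMap k K), z ∈ ({x, y} : Finset K) → φ z = z := by
        intro z hz hzxy
        rcases hz with hz | ⟨c, rfl⟩
        · exact hφU z (Finset.mem_union_right _ (Finset.mem_filter.2 ⟨hzxy, hz⟩))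
        · exact hφc c
      have hxf : φ x = x := fixA x hx (by simp)
      have hyf : φ y = y := fixA y hy (by simp)
      have hvf : φ v = v := by
        rcases hv with ⟨c, d, rfl⟩ | rfl | ⟨-, rfl⟩
        · rw [Algebra.smul_def, Algebra.smul_def, map_add, map_mul, map_mul, hφc, hφc, hxf, hyf]
        · rw [map_mul, hxf, hyf]
        · rw [map_inv₀, hxf]
      have hU'f : ∀ u ∈ U', φ u = u := by
        intro u hu
        by_cases huv : u = v
        · rw [huv, hvf]
        · exact hφU u (Finset.mem_union_left _ (Finset.mem_erase.2 ⟨huv, hu⟩))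
      intro w hw
      rcases List.mem_cons.1 hw with rfl | hw
      · exact hvf
      · exact hU'fix φ hφc hU'f w hw

/-- The same for the cost predicate: if `B` is derivable from `A` in `n` steps then some `U ⊆ A` with
`|U| ≤ 2n` controls `B` — every element of `B` is either an input or fixed by every constant-fixing
ring endomorphism fixing `U`. [folklore] -/
theorem derivable_exists_finset_fixed {n : ℕ} {A B : Set K} (h : Derivable k n A B) :
    ∃ U : Finset K, (↑U : Set K) ⊆ A ∧ U.card ≤ 2 * n ∧
      ∀ φ : K →+* K, (∀ c : k, φ (algebraMap k K c) = algebraMap k K c) →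
        (∀ u ∈ U, φ u = u) → ∀ b ∈ B, b ∈ A ∨ φ b = b := by
  obtain ⟨l, hl, hlen, hsub⟩ := h
  obtain ⟨U, hUA, hUcard, hUfix⟩ := divSeq_exists_finset_fixed l A hl
  refine ⟨U, hUA, hUcard.trans (by omega), fun φ hφc hφU b hb => ?_⟩
  rcases hsub hb with (h | ⟨c, rfl⟩) | h
  · exact Or.inl h
  · exact Or.inr (hφc c)
  · exact Or.inr (hUfix φ hφc hφU b h)

/-- With ALL of `K` as scalars every target is a "constant": derivable in `0` steps. [folklore] -/
theorem derivable_self_scalars (A B : Set K) (n : ℕ) : Derivable K n A B :=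
  Derivable.of_subset (fun b _ => Or.inr ⟨b, rfl⟩) n

end Model

/-! ### The generic determinant is not fixed by rescaling one of its variables -/

section Scale

variable {σ : Type} [DecidableEq σ]

/-- Rescaling one variable: `X p ↦ c · X p`, the other variables fixed (a `ℂ`-algebra endomorphism
of `ℂ[Z]`). [folklore] -/
def scaleHom (p : σ) (c : ℂ) : MvPolynomial σ ℂ →ₐ[ℂ] MvPolynomial σ ℂ :=
  MvPolynomial.aeval fun q => if q = p then MvPolynomial.C c * MvPolynomial.X q else MvPolynomial.X q

theorem scaleHom_X (p q : σ) (c : ℂ) :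
    scaleHom p c (MvPolynomial.X q) =
      if q = p then MvPolynomial.C c * MvPolynomial.X q else MvPolynomial.X q :=
  MvPolynomial.aeval_X _ _

theorem scaleHom_comp (p : σ) (c d : ℂ) :
    (scaleHom p c).comp (scaleHom p d) = scaleHom p (d * c) := by
  apply MvPolynomial.algHom_ext
  intro q
  simp only [AlgHom.comp_apply, scaleHom_X]
  split_ifs with h
  · subst h
    have hC : scaleHom q c (MvPolynomial.C d) = MvPolynomial.C d := (scaleHom q c).commutes d
    rw [map_mul, hC, scaleHom_X, if_pos rfl, map_mul]
    ring
  · rw [scaleHom_X, if_neg h]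

theorem scaleHom_one (p : σ) : scaleHom p 1 = AlgHom.id ℂ _ := by
  apply MvPolynomial.algHom_ext
  intro q
  rw [scaleHom_X]
  split_ifs <;> simp

/-- `X p ↦ 2 · X p` as a `ℂ`-algebra automorphism of `ℂ[Z]`. [folklore] -/
def scaleEquiv (p : σ) : MvPolynomial σ ℂ ≃ₐ[ℂ] MvPolynomial σ ℂ :=
  AlgEquiv.ofAlgHom (scaleHom p 2) (scaleHom p 2⁻¹)
    (by rw [scaleHom_comp]; norm_num; exact scaleHom_one p)
    (by rw [scaleHom_comp]; norm_num; exact scaleHom_one p)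

theorem scaleEquiv_apply (p : σ) (f : MvPolynomial σ ℂ) : scaleEquiv p f = scaleHom p 2 f := rfl

theorem eval_scaleHom (a : σ → ℂ) (p : σ) (c : ℂ) (f : MvPolynomial σ ℂ) :
    MvPolynomial.eval a (scaleHom p c f) =
      MvPolynomial.eval (fun q => if q = p then c * a q else a q) f := by
  have key : (MvPolynomial.aeval a).comp (scaleHom p c) =
      MvPolynomial.aeval (R := ℂ) (fun q => if q = p then c * a q else a q) := by
    apply MvPolynomial.algHom_ext
    intro q
    simp only [AlgHom.comp_apply, scaleHom_X, MvPolynomial.aeval_X]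
    split_ifs with h
    · simp [map_mul]
    · simp
  have h := congrArg (fun ψ => ψ f) key
  simpa [MvPolynomial.coe_aeval_eq_eval] using h

end Scale

/-! ### The crux's objects -/

section Det

/-- The inputs of the crux's hypothesis: the entries of the generic `n × m'` matrix `Z`, in
`Frac ℂ[Z]`. -/
abbrev inputs (n m' : ℕ) : Set (FractionRing (MvPolynomial (Fin n × Fin m') ℂ)) :=
  Set.range fun p : Fin n × Fin m' =>
    algebraMap (MvPolynomial (Fin n × Fin m') ℂ) (FractionRing (MvPolynomial (Fin n × Fin m') ℂ))
      (MvPolynomial.X p)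

/-- The target polynomial of the crux's hypothesis: `det X`, `X` the leading `n × n` block of `Z`. -/
abbrev detX (n m' : ℕ) (h : n ≤ m') : MvPolynomial (Fin n × Fin m') ℂ :=
  Matrix.det (Matrix.of fun i j : Fin n => MvPolynomial.X (i, Fin.castLE h j))

variable {n m' : ℕ} (h : n ≤ m')

theorem eval_detX (a : Fin n × Fin m' → ℂ) :
    MvPolynomial.eval a (detX n m' h) = Matrix.det (Matrix.of fun i j : Fin n => a (i, Fin.castLE h j)) := by
  rw [RingHom.map_det]
  congr 1
  ext i j
  simp

/-- `det X` is not one of the variables once `n ≥ 2` (evaluate at `2·I`). [folklore] -/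
theorem detX_ne_X (hn : 2 ≤ n) (q : Fin n × Fin m') : detX n m' h ≠ MvPolynomial.X q := by
  intro heq
  set a : Fin n × Fin m' → ℂ := fun r => if r.2 = Fin.castLE h r.1 then 2 else 0 with ha
  have h1 := congrArg (MvPolynomial.eval a) heq
  rw [eval_detX, MvPolynomial.eval_X] at h1
  have hM : (Matrix.of fun i j : Fin n => a (i, Fin.castLE h j)) = Matrix.diagonal fun _ => (2 : ℂ) := by
    ext i j
    simp only [Matrix.of_apply, ha, (Fin.castLE_injective h).eq_iff, Matrix.diagonal_apply]
    simp only [eq_comm]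
  rw [hM, Matrix.det_diagonal, Finset.prod_const, Finset.card_univ, Fintype.card_fin] at h1
  have h4 : 2 ^ 2 ≤ 2 ^ n := Nat.pow_le_pow_right (by norm_num) hn
  simp only [ha] at h1
  split_ifs at h1 with hc
  · have h2 : (2 ^ n : ℕ) = 2 := by exact_mod_cast h1
    rw [h2] at h4
    norm_num at h4
  · exact absurd h1 (pow_ne_zero _ two_ne_zero)

/-- `det X` is not fixed by `X_{i₀j₀} ↦ 2 X_{i₀j₀}` (evaluate at the permutation matrix of the
transposition `(i₀ j₀)`: the determinant `±1` doubles). [folklore] -/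
theorem scaleHom_detX_ne (i₀ j₀ : Fin n) :
    scaleHom (i₀, Fin.castLE h j₀) 2 (detX n m' h) ≠ detX n m' h := by
  classical
  intro heq
  set π : Equiv.Perm (Fin n) := Equiv.swap i₀ j₀ with hπ
  set a : Fin n × Fin m' → ℂ := fun r => if r.2 = Fin.castLE h (π r.1) then 1 else 0 with ha
  set P : Matrix (Fin n) (Fin n) ℂ := Matrix.of fun i j : Fin n => a (i, Fin.castLE h j) with hP
  have hPperm : P = Equiv.Perm.permMatrix ℂ π := by
    ext i j
    simp only [hP, Matrix.of_apply, ha, (Fin.castLE_injective h).eq_iff, Equiv.Perm.permMatrix,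
      PEquiv.toMatrix_apply, Equiv.toPEquiv_apply, Option.mem_def, Option.some.injEq]
    simp only [eq_comm]
  have hProw : ∀ j, P i₀ j = if j = j₀ then 1 else 0 := by
    intro j
    simp [hP, ha, hπ, (Fin.castLE_injective h).eq_iff, Equiv.swap_apply_left]
  have hdetP : P.det ≠ 0 := by
    rw [hPperm, Matrix.det_permutation]
    exact_mod_cast (Equiv.Perm.sign π).ne_zero
  have h1 := congrArg (MvPolynomial.eval a) heq
  rw [eval_scaleHom, eval_detX, eval_detX] at h1
  have hM' : (Matrix.of fun i j : Fin n =>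
      if ((i, Fin.castLE h j) : Fin n × Fin m') = (i₀, Fin.castLE h j₀) then 2 * a (i, Fin.castLE h j)
      else a (i, Fin.castLE h j)) = P.updateRow i₀ ((2 : ℂ) • P i₀) := by
    ext i j
    rw [Matrix.updateRow_apply]
    simp only [Matrix.of_apply, Prod.mk.injEq, (Fin.castLE_injective h).eq_iff, Pi.smul_apply,
      smul_eq_mul]
    change (if i = i₀ ∧ j = j₀ then 2 * P i j else P i j) = _
    by_cases hi : i = i₀
    · rw [if_pos hi, hi]
      by_cases hj : j = j₀
      · rw [if_pos ⟨rfl, hj⟩]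
      · rw [if_neg (fun hh => hj hh.2), hProw, if_neg hj, mul_zero]
    · rw [if_neg (fun hh => hi hh.1), if_neg hi]
  have h2 : (P.updateRow i₀ ((2 : ℂ) • P i₀)).det = P.det := by rw [← hM']; exact h1
  rw [Matrix.det_updateRow_smul, Matrix.updateRow_eq_self] at h2
  exact hdetP (by linear_combination h2)

/-- **Fan-in lower bound.** A derivation of `det X` (`X` the leading `n × n` block of the generic
`n × m'` matrix `Z`, `n ≥ 2`) from the entries of `Z` in the model `Derivable` reads at least the
`n²` entries of `X`, two per step: its length is at least `n²/2`. [folklore] -/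
theorem sq_le_two_mul_of_derivable_detX (hn : 2 ≤ n) {s : ℕ}
    (hD : Derivable ℂ s (inputs n m')
      {algebraMap (MvPolynomial (Fin n × Fin m') ℂ) (FractionRing (MvPolynomial (Fin n × Fin m') ℂ))
        (detX n m' h)}) :
    n ^ 2 ≤ 2 * s := by
  classical
  set K := FractionRing (MvPolynomial (Fin n × Fin m') ℂ)
  set ι := algebraMap (MvPolynomial (Fin n × Fin m') ℂ) K with hι
  obtain ⟨U, hUA, hUcard, hUfix⟩ := derivable_exists_finset_fixed hD
  have key : ∀ i₀ j₀ : Fin n, ι (MvPolynomial.X (i₀, Fin.castLE h j₀)) ∈ U := by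
    intro i₀ j₀
    by_contra hnot
    set p : Fin n × Fin m' := (i₀, Fin.castLE h j₀) with hp
    let φ : K →+* K := (IsFractionRing.ringEquivOfRingEquiv (scaleEquiv p).toRingEquiv).toRingHom
    have hφι : ∀ f, φ (ι f) = ι (scaleEquiv p f) := fun f =>
      IsFractionRing.ringEquivOfRingEquiv_algebraMap (scaleEquiv p).toRingEquiv f
    have hφc : ∀ c : ℂ, φ (algebraMap ℂ K c) = algebraMap ℂ K c := by
      intro c
      rw [IsScalarTower.algebraMap_apply ℂ (MvPolynomial (Fin n × Fin m') ℂ) K c, ← hι, hφι,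
        AlgEquiv.commutes]
    have hφU : ∀ u ∈ U, φ u = u := by
      intro u hu
      obtain ⟨q, rfl⟩ := hUA hu
      have hqp : q ≠ p := fun hqp => hnot (hqp ▸ hu)
      change φ (ι (MvPolynomial.X q)) = ι (MvPolynomial.X q)
      rw [hφι, scaleEquiv_apply, scaleHom_X, if_neg hqp]
    rcases hUfix φ hφc hφU _ rfl with hmem | hfix
    · obtain ⟨q, hq⟩ := hmem
      exact detX_ne_X h hn q (IsFractionRing.injective _ _ hq).symm
    · change φ (ι (detX n m' h)) = ι (detX n m' h) at hfix
      rw [hφι, scaleEquiv_apply] at hfix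
      exact scaleHom_detX_ne h i₀ j₀ (IsFractionRing.injective _ _ hfix)
  have hinj : Function.Injective fun ij : Fin n × Fin n => ι (MvPolynomial.X (ij.1, Fin.castLE h ij.2)) := by
    intro a b hab
    have h1 : (MvPolynomial.X (a.1, Fin.castLE h a.2) : MvPolynomial (Fin n × Fin m') ℂ) =
        MvPolynomial.X (b.1, Fin.castLE h b.2) := IsFractionRing.injective _ _ hab
    have h2 := MvPolynomial.X_injective h1
    simp only [Prod.mk.injEq, (Fin.castLE_injective h).eq_iff] at h2
    exact Prod.ext h2.1 h2.2
  have hcard : (Finset.univ.image fun ij : Fin n × Fin n =>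
      ι (MvPolynomial.X (ij.1, Fin.castLE h ij.2))).card = n ^ 2 := by
    rw [Finset.card_image_of_injective _ hinj, Finset.card_univ, Fintype.card_prod, Fintype.card_fin, sq]
  have hsub : (Finset.univ.image fun ij : Fin n × Fin n =>
      ι (MvPolynomial.X (ij.1, Fin.castLE h ij.2))) ⊆ U := by
    intro u hu
    obtain ⟨ij, -, rfl⟩ := Finset.mem_image.1 hu
    exact key ij.1 ij.2
  calc n ^ 2 = _ := hcard.symm
    _ ≤ U.card := Finset.card_le_card hsub
    _ ≤ 2 * s := hUcard

end Det

/-! ### Load-bearing analysis of the exponent guard `2 ≤ τ`: it is idle -/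

section Guard

/-- The hypothesis of the crux at exponent `τ` (verbatim). -/
def Hyp (τ : ℝ) : Prop :=
  ∃ C : ℝ, ∃ n₀ : ℕ, ∀ n ≥ n₀, ∃ (m' : ℕ) (h : n ≤ m') (s : ℕ), (s : ℝ) ≤ C * (n : ℝ) ^ τ ∧ Literature.Computability.AlgebraicComplexity.Derivable ℂ s (Set.range fun p : Fin n × Fin m' => algebraMap (MvPolynomial (Fin n × Fin m') ℂ) (FractionRing (MvPolynomial (Fin n × Fin m') ℂ)) (MvPolynomial.X p)) {algebraMap (MvPolynomial (Fin n × Fin m') ℂ) (FractionRing (MvPolynomial (Fin n × Fin m') ℂ)) (Matrix.det (Matrix.of fun i j : Fin n => MvPolynomial.X (i, Fin.castLE h j)))}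

/-- Read-back: the crux is `∀ τ ≥ 2, Hyp τ → ω(ℂ) ≤ τ`. -/
theorem derivationsBoundOmega_iff_hyp :
    DerivationsBoundOmega ↔ ∀ τ : ℝ, 2 ≤ τ → Hyp τ → omega ℂ ≤ τ := Iff.rfl

/-- **Boundary lemma: below exponent `2` the hypothesis is unsatisfiable** (fan-in: a derivation of
`det X_n` has length `≥ n²/2`). [folklore] -/
theorem not_hyp_of_lt_two {τ : ℝ} (hτ : τ < 2) : ¬ Hyp τ := by
  rintro ⟨C, n₀, hC⟩
  have hev : ∀ᶠ n : ℕ in Filter.atTop, 2 * C < (n : ℝ) ^ (2 - τ) :=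
    ((tendsto_rpow_atTop (by linarith : 0 < 2 - τ)).comp tendsto_natCast_atTop_atTop).eventually_gt_atTop _
  obtain ⟨N, hN⟩ := Filter.eventually_atTop.1 hev
  set n := max N (max n₀ 2) with hn
  have hnN : N ≤ n := le_max_left _ _
  have hn0 : n₀ ≤ n := (le_max_left _ _).trans (le_max_right _ _)
  have hn2 : 2 ≤ n := (le_max_right _ _).trans (le_max_right _ _)
  obtain ⟨m', h, s, hs, hD⟩ := hC n hn0
  have hsq := sq_le_two_mul_of_derivable_detX h hn2 hD
  have hnpos : (0 : ℝ) < n := by exact_mod_cast (show 0 < n by omega)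
  have hpow : (0 : ℝ) < (n : ℝ) ^ τ := Real.rpow_pos_of_pos hnpos τ
  have h1 : (n : ℝ) ^ (2 : ℝ) ≤ 2 * C * (n : ℝ) ^ τ := by
    have : ((n ^ 2 : ℕ) : ℝ) ≤ ((2 * s : ℕ) : ℝ) := by exact_mod_cast hsq
    push_cast at this
    rw [Real.rpow_two]
    nlinarith [this, hs]
  have h2 : (n : ℝ) ^ (2 - τ) * (n : ℝ) ^ τ ≤ 2 * C * (n : ℝ) ^ τ := by
    rwa [← Real.rpow_add hnpos, sub_add_cancel]
  have h3 : (n : ℝ) ^ (2 - τ) ≤ 2 * C := le_of_mul_le_mul_right h2 hpow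
  exact absurd (hN n hnN) (not_lt.2 h3)

/-- The crux with the guard `2 ≤ τ` DROPPED. -/
def DerivationsBoundOmegaAllExponents : Prop :=
  ∀ τ : ℝ, Hyp τ → omega ℂ ≤ τ

/-- **The guard `2 ≤ τ` is idle**: dropping it does not change the statement (for `τ < 2` the
hypothesis is empty). Information for the prover: no proof needs `2 ≤ τ`. [folklore] -/
theorem derivationsBoundOmega_iff_allExponents :
    DerivationsBoundOmega ↔ DerivationsBoundOmegaAllExponents :=
  ⟨fun H τ hH => if hτ : 2 ≤ τ then H τ hτ hH else absurd hH (not_hyp_of_lt_two (not_le.mp hτ)),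
    fun H τ _ hH => H τ hH⟩

end Guard

/-! ### Load-bearing analysis of the scalars `k = ℂ` and of the cost bound: dropping either one
turns the crux into `ω(ℂ) ≤ 2`, i.e. into the summit itself -/

section Scalars

/-- The crux with the SCALARS of the cost model widened from `ℂ` to the whole function field
`K = Frac ℂ[Z]` (`Derivable K` instead of `Derivable ℂ`: every element of `K` is then a free
"constant"). -/
def DerivationsBoundOmegaFieldScalars : Prop :=
  ∀ τ : ℝ, 2 ≤ τ → (∃ C : ℝ, ∃ n₀ : ℕ, ∀ n ≥ n₀, ∃ (m' : ℕ) (h : n ≤ m') (s : ℕ), (s : ℝ) ≤ C * (n : ℝ) ^ τ ∧ Literature.Computability.AlgebraicComplexity.Derivable (FractionRing (MvPolynomial (Fin n × Fin m') ℂ)) s (Set.range fun p : Fin n × Fin m' => algebraMap (MvPolynomial (Fin n × Fin m') ℂ) (FractionRing (MvPolynomial (Fin n × Fin m') ℂ)) (MvPolynomial.X p)) {algebraMap (MvPolynomial (Fin n × Fin m') ℂ) (FractionRing (MvPolynomial (Fin n × Fin m') ℂ)) (Matrix.det (Matrix.of fun i j : Fin n => MvPolynomial.X (i, Fin.castLE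 h j)))}) → Literature.Computability.AlgebraicComplexity.omega ℂ ≤ τ

/-- **The scalar field `ℂ` (first argument of `Derivable`) is load-bearing to the hilt**: with `K`
itself as scalars the hypothesis holds with `s = 0`, and the statement becomes `ω(ℂ) ≤ 2` — the
summit. (So this variant is exactly as hard as `MatrixMultiplication`; it is not refutable either.)
[folklore] -/
theorem derivationsBoundOmegaFieldScalars_iff :
    DerivationsBoundOmegaFieldScalars ↔ omega ℂ ≤ 2 := by
  constructor
  · intro H
    refine H 2 le_rfl ⟨0, 0, fun n _ => ⟨n, le_rfl, 0, by simp, derivable_self_scalars _ _ _⟩⟩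
  · intro hω τ hτ _
    exact hω.trans hτ

end Scalars

section CostBound

variable {k : Type u} {K : Type v} [CommSemiring k] [Field K] [Algebra k K]

/-- Finite products of available elements: `∏_{i ∈ s} x_i` costs at most `|s|` steps. [folklore] -/
theorem derivable_finset_prod {ι : Type*} (s : Finset ι) {A : Set K} {x : ι → K}
    (hx : ∀ i ∈ s, x i ∈ A ∪ Set.range (algebraMap k K)) :
    Derivable k s.card A {∏ i ∈ s, x i} := by
  classical
  induction s using Finset.induction_on with
  | empty =>
    refine Derivable.of_subset ?_ _
    intro v hv
    simp only [Finset.prod_empty, Set.mem_singleton_iff] at hv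
    exact Or.inr ⟨1, by simp [hv]⟩
  | insert a s ha ih =>
    rw [Finset.card_insert_of_notMem ha, Finset.prod_insert ha]
    have h1 := ih fun i hi => hx i (Finset.mem_insert_of_mem hi)
    refine h1.trans ?_
    have := Derivable.mul (k := k) (A := A ∪ {∏ i ∈ s, x i}) (x := x a)
      (y := ∏ i ∈ s, x i) ?_ (Or.inl (Or.inr rfl))
    · simpa using this
    · rcases hx a (Finset.mem_insert_self a s) with h | h
      · exact Or.inl (Or.inl h)
      · exact Or.inr h

variable {n m' : ℕ}

/-- **Non-vacuity of the unbounded hypothesis**: `det X` IS derivable from the entries of `Z` — by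
the Leibniz expansion, in `(n+1)!` steps (`n!` products of `n` factors, then one weighted sum of
`n!` terms). [folklore] -/
theorem derivable_detX (h : n ≤ m') :
    Derivable ℂ (Nat.factorial (n + 1)) (inputs n m')
      {algebraMap (MvPolynomial (Fin n × Fin m') ℂ) (FractionRing (MvPolynomial (Fin n × Fin m') ℂ))
        (detX n m' h)} := by
  classical
  set K := FractionRing (MvPolynomial (Fin n × Fin m') ℂ)
  set ι := algebraMap (MvPolynomial (Fin n × Fin m') ℂ) K with hι
  set P : Equiv.Perm (Fin n) → K := fun σ => ∏ i, ι (MvPolynomial.X (σ i, Fin.castLE h i)) with hPdef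
  have hP : ∀ σ, Derivable ℂ n (inputs n m') {P σ} := by
    intro σ
    have := derivable_finset_prod (k := ℂ) (Finset.univ : Finset (Fin n)) (A := inputs n m')
      (x := fun i => ι (MvPolynomial.X (σ i, Fin.castLE h i))) (fun i _ => Or.inl ⟨(σ i, Fin.castLE h i), rfl⟩)
    simpa [P] using this
  have hU : Derivable ℂ (∑ σ ∈ (Finset.univ : Finset (Equiv.Perm (Fin n))), n) (inputs n m')
      (⋃ σ ∈ (Finset.univ : Finset (Equiv.Perm (Fin n))), {P σ}) :=
    Derivable.biUnion Finset.univ fun σ _ => hP σ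
  have hS : Derivable ℂ (Finset.univ : Finset (Equiv.Perm (Fin n))).card
      (inputs n m' ∪ ⋃ σ ∈ (Finset.univ : Finset (Equiv.Perm (Fin n))), {P σ})
      {∑ σ ∈ (Finset.univ : Finset (Equiv.Perm (Fin n))), ((Equiv.Perm.sign σ : ℤ) : ℂ) • P σ} :=
    Derivable.sum Finset.univ (fun σ => ((Equiv.Perm.sign σ : ℤ) : ℂ)) fun σ _ =>
      Or.inl (Or.inr (Set.mem_biUnion (Finset.mem_univ σ) rfl))
  have hT := hU.trans hS
  refine hT.mono ?_ subset_rfl ?_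
  · simp only [Finset.sum_const, Finset.card_univ, Fintype.card_perm, Fintype.card_fin, smul_eq_mul,
      Nat.factorial_succ]
    exact le_of_eq (by ring)
  · intro x hx
    rw [Set.mem_singleton_iff] at hx ⊢
    subst hx
    rw [show detX n m' h = Matrix.det (Matrix.of fun i j : Fin n => MvPolynomial.X (i, Fin.castLE h j))
      from rfl, Matrix.det_apply', map_sum]
    refine Finset.sum_congr rfl fun σ _ => ?_
    rw [map_mul, map_prod, Algebra.smul_def]
    congr 1

/-- The crux with the COST BOUND dropped (any length will do). -/
def DerivationsBoundOmegaNoCostBound : Prop :=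
  ∀ τ : ℝ, 2 ≤ τ → (∃ n₀ : ℕ, ∀ n ≥ n₀, ∃ (m' : ℕ) (h : n ≤ m') (s : ℕ), Literature.Computability.AlgebraicComplexity.Derivable ℂ s (Set.range fun p : Fin n × Fin m' => algebraMap (MvPolynomial (Fin n × Fin m') ℂ) (FractionRing (MvPolynomial (Fin n × Fin m') ℂ)) (MvPolynomial.X p)) {algebraMap (MvPolynomial (Fin n × Fin m') ℂ) (FractionRing (MvPolynomial (Fin n × Fin m') ℂ)) (Matrix.det (Matrix.of fun i j : Fin n => MvPolynomial.X (i, Fin.castLE h j)))}) → Literature.Computability.AlgebraicComplexity.omega ℂ ≤ τ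

/-- **The cost bound is load-bearing to the hilt**: without it the hypothesis is a theorem (Leibniz,
`derivable_detX`) and the statement is `ω(ℂ) ≤ 2`, the summit. [folklore] -/
theorem derivationsBoundOmegaNoCostBound_iff :
    DerivationsBoundOmegaNoCostBound ↔ omega ℂ ≤ 2 := by
  constructor
  · intro H
    exact H 2 le_rfl ⟨0, fun n _ => ⟨n, le_rfl, Nat.factorial (n + 1), derivable_detX le_rfl⟩⟩
  · intro hω τ hτ _
    exact hω.trans hτ

/-- The crux with the constant `C` allowed to depend on `n` (`∃ C` moved inside `∀ n`). -/
def DerivationsBoundOmegaPointwiseConstant : Prop :=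
  ∀ τ : ℝ, 2 ≤ τ → (∃ n₀ : ℕ, ∀ n ≥ n₀, ∃ C : ℝ, ∃ (m' : ℕ) (h : n ≤ m') (s : ℕ), (s : ℝ) ≤ C * (n : ℝ) ^ τ ∧ Literature.Computability.AlgebraicComplexity.Derivable ℂ s (Set.range fun p : Fin n × Fin m' => algebraMap (MvPolynomial (Fin n × Fin m') ℂ) (FractionRing (MvPolynomial (Fin n × Fin m') ℂ)) (MvPolynomial.X p)) {algebraMap (MvPolynomial (Fin n × Fin m') ℂ) (FractionRing (MvPolynomial (Fin n × Fin m') ℂ)) (Matrix.det (Matrix.of fun i j : Fin n => MvPolynomial.X (i, Fin.castLE h j)))}) → Literature.Computability.AlgebraicComplexity.omega ℂ ≤ τ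

/-- **The quantifier order `∃ C … ∀ n` is load-bearing**: with `C` depending on `n` the hypothesis
is a theorem (`C := (n+1)!`, `n ≥ 1`) and the statement is again `ω(ℂ) ≤ 2`. [folklore] -/
theorem derivationsBoundOmegaPointwiseConstant_iff :
    DerivationsBoundOmegaPointwiseConstant ↔ omega ℂ ≤ 2 := by
  constructor
  · intro H
    refine H 2 le_rfl ⟨1, fun n hn => ⟨Nat.factorial (n + 1), n, le_rfl, Nat.factorial (n + 1), ?_,
      derivable_detX le_rfl⟩⟩
    have h1 : (1 : ℝ) ≤ (n : ℝ) ^ (2 : ℝ) := by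
      rw [Real.rpow_two]
      have : (1 : ℝ) ≤ n := by exact_mod_cast hn
      nlinarith
    have h0 : (0 : ℝ) ≤ (Nat.factorial (n + 1) : ℝ) := by positivity
    nlinarith
  · intro hω τ hτ _
    exact hω.trans hτ

end CostBound

/-! ### A natural strengthening refuted: no single `n` certifies an exponent -/

section SingleInstance

/-- `det X₂ = X₀₀ X₁₁ − X₀₁ X₁₀` is derivable in `3` steps (two products, one linear combination);
cf. `witness_two` of the crux-attack file. [folklore] -/
theorem derivable_detX_two (m' : ℕ) (h : 2 ≤ m') :
    Derivable ℂ 3 (inputs 2 m')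
      {algebraMap (MvPolynomial (Fin 2 × Fin m') ℂ) (FractionRing (MvPolynomial (Fin 2 × Fin m') ℂ))
        (detX 2 m' h)} := by
  set K := FractionRing (MvPolynomial (Fin 2 × Fin m') ℂ)
  set ι := algebraMap (MvPolynomial (Fin 2 × Fin m') ℂ) K with hι
  have mem : ∀ (i : Fin 2) (j : Fin 2), ι (MvPolynomial.X (i, Fin.castLE h j)) ∈ inputs 2 m' :=
    fun i j => ⟨(i, Fin.castLE h j), rfl⟩
  set a := ι (MvPolynomial.X ((0 : Fin 2), Fin.castLE h 0))
  set b := ι (MvPolynomial.X ((0 : Fin 2), Fin.castLE h 1))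
  set c := ι (MvPolynomial.X ((1 : Fin 2), Fin.castLE h 0))
  set d := ι (MvPolynomial.X ((1 : Fin 2), Fin.castLE h 1))
  have h1 : Derivable ℂ 1 (inputs 2 m') {a * d} := Derivable.mul (Or.inl (mem 0 0)) (Or.inl (mem 1 1))
  have h2 : Derivable ℂ 1 (inputs 2 m' ∪ {a * d}) {b * c} :=
    Derivable.mul (Or.inl (Or.inl (mem 0 1))) (Or.inl (Or.inl (mem 1 0)))
  have h3 : Derivable ℂ 1 ((inputs 2 m' ∪ {a * d}) ∪ {b * c}) {(1 : ℂ) • (a * d) + (-1 : ℂ) • (b * c)} :=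
    Derivable.lin (k := ℂ) (A := (inputs 2 m' ∪ {a * d}) ∪ {b * c}) (x := a * d) (y := b * c)
      (Or.inl (Or.inl (Or.inr rfl))) (Or.inl (Or.inr rfl)) 1 (-1)
  have h123 : Derivable ℂ 3 (inputs 2 m') {(1 : ℂ) • (a * d) + (-1 : ℂ) • (b * c)} :=
    Derivable.trans h1 (Derivable.trans h2 h3)
  refine h123.mono le_rfl subset_rfl ?_
  intro x hx
  rw [Set.mem_singleton_iff] at hx ⊢
  subst hx
  rw [show detX 2 m' h = Matrix.det (Matrix.of fun i j : Fin 2 => MvPolynomial.X (i, Fin.castLE h j))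
    from rfl, Matrix.det_fin_two]
  simp only [Matrix.of_apply, map_sub, map_mul, one_smul, neg_one_smul]
  simp only [a, b, c, d]
  ring

/-- The NON-ASYMPTOTIC strengthening of the crux: one size `n ≥ 2` with a derivation of length
`≤ n^τ` already gives `ω(ℂ) ≤ τ`. -/
def DerivationsBoundOmegaSingleInstance : Prop :=
  ∀ τ : ℝ, ∀ n ≥ 2, (∃ (m' : ℕ) (h : n ≤ m') (s : ℕ), (s : ℝ) ≤ (n : ℝ) ^ τ ∧ Literature.Computability.AlgebraicComplexity.Derivable ℂ s (Set.range fun p : Fin n × Fin m' => algebraMap (MvPolynomial (Fin n × Fin m') ℂ) (FractionRing (MvPolynomial (Fin n × Fin m') ℂ)) (MvPolynomial.X p)) {algebraMap (MvPolynomial (Fin n × Fin m') ℂ) (FractionRing (MvPolynomial (Fin n × Fin m') ℂ)) (Matrix.det (Matrix.of fun i j : Fin n => MvPolynomial.X (i, Fin.castLE h j)))}) → Literature.Computability.AlgebraicComplexity.omega ℂ ≤ τ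

/-- **Refutation of the single-instance strengthening** (small model `n = 2`): `det X₂` costs `3`
steps and `3 = 2^{log₂ 3}`, so the strengthening would give `ω(ℂ) ≤ log₂ 3 < 2`, contradicting the
flattening bound `ω(ℂ) ≥ 2`. The `n → ∞` limit in the crux (`∃ C n₀ ∀ n ≥ n₀`) is essential — as for
every exponent statement (Infimum-not-minimum). [folklore] -/
theorem not_derivationsBoundOmegaSingleInstance : ¬ DerivationsBoundOmegaSingleInstance := by
  intro H
  have h3 : (0 : ℝ) < 3 := by norm_num
  have hlt : Real.logb 2 3 < 2 := by
    rw [Real.logb_lt_iff_lt_rpow one_lt_two h3]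
    norm_num
  have hle : omega ℂ ≤ Real.logb 2 3 := by
    refine H (Real.logb 2 3) 2 le_rfl ⟨2, le_rfl, 3, ?_, derivable_detX_two 2 le_rfl⟩
    rw [show ((2 : ℕ) : ℝ) = 2 by norm_num, Real.rpow_logb two_pos (by norm_num) h3]
    norm_num
  have h2 := omega_two_le ℂ
  linarith

end SingleInstance

end Summit.MatrixMultiplication.MatrixMultiplication.Cruxes.DerivationsBoundOmega.Disproof

end
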